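import Summits.MatrixMultiplication.MatrixMultiplication.Theorems.AbelianSTPPCensusTB5StatDefs

/-!
# T_B static certificate, range `5995 … 6012` (t*-indexed linear checker with the k-member tree at `τ = 2375/1000`): kernel evaluation, the shape checks (one-member cover, else the k-member tree), volumes `1191 … 1560`, all orders `5995 … 6012`

Cell mm-stpp (rung F-M1), tier T_B = «beat `2.375` (Coppersmith–Winograd)»; checker in `AbelianSTPPCensusTB5StatDefs.lean`, table and bucket lists in `AbelianSTPPCensusTB5StatData.lean`
(pattern: theory g12's `AbelianSTPPCensusTAStatDDom*/DCk*.lean`).  `decide` with kernel reduction (standard axioms; no `native_decide`), `Elab.async false`;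
consumed by `TB5Stat.checkV_sound` / `TB5Stat.domV_sound` / `TB5Stat.m2V_sound` in the leaf `AbelianSTPPCensusLeafTB6012Closed.lean`.
WHAT THIS IS NOT: arithmetic on shape lists only; no statement about STPP families or `ω`.
-/

set_option linter.dupNamespace false
set_option autoImplicit false
set_option Elab.async false

namespace Summit.MatrixMultiplication.MatrixMultiplication.Theorems.TB5Stat

set_option maxHeartbeats 0 in
/-- Check chunk: every sorted candidate shape of the volumes `1191 … 1377` passes `checkShape` on the full order range (cost units 199647: (shape, bucket) cells and tree nodes). [original] -/
theorem ck1191 : TB5Stat.checkV 5995 6012 187 1191 = true := by decide +kernel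

set_option maxHeartbeats 0 in
/-- Check chunk: every sorted candidate shape of the volumes `1378 … 1560` passes `checkShape` on the full order range (cost units 199863: (shape, bucket) cells and tree nodes). [original] -/
theorem ck1378 : TB5Stat.checkV 5995 6012 183 1378 = true := by decide +kernel

end Summit.MatrixMultiplication.MatrixMultiplication.Theorems.TB5Stat
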